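import Literature.Probability.Percolation.NonBacktrackingPathCounting
import Literature.Probability.FitznerVanDerHofstad2017.NbwTwoStepRecursion
import HarnessLib

/-!
# Memory-`τ` walk automata: accepted-word counts, the Collatz–Wielandt counting bound, and the exact
# dangerous-set abstraction of memory-`τ` self-avoiding words on `ℤ^d`

Cell `prim-pcint` (PAPER-2 track (iii), certified intervals for `p_c(ℤ^d)`), seat `prim-pcint-1`; support file
(`--supports stmt-CriticalPhenomena-4575`).  Independent of p205010: the only percolation input downstream is the tree's
path counting `theta_le_card_sawWords_mul_pow` (Grimmett 1999 (1.15)).  Lane files: run/shared/lean/prim/pcint/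
(REDUCTIONS.md §B1, CERTIFICATE-FORMAT.md §B1, step0/).

Printed statements behind this file:
* Madras–Slade 1993, §1.2 (1.2.12)–(1.2.14) pp. 10–11: walks with finite memory `τ`, `c_{N,τ}` (sites at times
  `0 < |i-j| ≤ τ` distinct), `μ ≤ μ_τ = inf_N c_{N,τ}^{1/N}`, memory-4 constant of Fisher–Sykes;
* Pönitz–Tittmann 2000 (Electron. J. Combin. 7, R21), §2–§3 and Table 2: the finite automaton `A(d,k)` counting walks
  with memory `k` whose states record only "the part of the history that can still contribute to a loop of length ≤ k",
  and its Perron root as an upper bound for `μ(d)`;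
* Collatz–Wielandt: for a nonnegative matrix `M` and a positive vector `V` with `MV ≤ λV`, `ρ(M) ≤ λ` — used here in
  the elementary counting form `m·denⁿ·#{accepted words of length n} ≤ numⁿ·V(start)`.

What is PROVED here (no `sorry`, standard axioms, all `d` and all `τ ≥ 2`):
* `runW`/`cnt`: runs and accepted-word counts of a partial deterministic automaton; `card_accepted_eq_cnt`;
  `cnt_le_of_certificate` (the Collatz–Wielandt counting bound on a closed set of states);
  `cnt_eq_of_simulation_on` (simulations preserve counts);
* `mstep τ` — the memory-`τ` automaton on "dangerous-set" states `Finset (Site d × ℕ)` (pairs (relative site, age),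
  kept while the site can still be revisited inside the memory window); `danger τ w` — the dangerous set of a word;
  `mstep_danger_wordInit` — THE ABSTRACTION IS EXACT: reading the last letter of a memory-`τ` word from the dangerous
  set of its prefix is allowed and yields its dangerous set; hence `runW_mstep_of_isMem` and
  `card_sawWords_le_cnt : (sawWords d n).card ≤ cnt (mstep τ) ∅ n` (`σ(n) ≤ c_{n,τ} ≤` automaton count).
The companion file `…PcintMemCert` turns a finite, decidable certificate for `mstep τ` into `p_c(ℤ^d) ≥ den/num`.

## References
* N. Madras, G. Slade, *The Self-Avoiding Walk*, Birkhäuser 1993, §1.2 pp. 10–12 [MadrasSlade1993].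
* A. Pönitz, P. Tittmann, *Improved upper bounds for self-avoiding walks in ℤ^d*, Electron. J. Combin. 7 (2000) R21,
  doi:10.37236/1499 [PonitzTittmann2000].
* G. Grimmett, *Percolation*, 2nd ed., Springer 1999, §1.4 (1.13)–(1.16) pp. 15–16 [GrimmettPercolation1999].
-/

noncomputable section

namespace Summit.CriticalPhenomena.PercolationContinuityZ3.Theorems.Pcint

open Literature.Probability.Percolation Literature.Probability.LatticeModels
open Literature.Probability.FitznerVanDerHofstad2017 (wordPos_wordInit)

/-! ### Abstract partial deterministic automata: runs, accepted-word counts, Collatz–Wielandt bound -/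

section Automaton

variable {σ α : Type*}

/-- Run of a partial deterministic automaton `step` on a word `w : Fin n → α`, read from the left
(`none` = rejected). Defined by peeling the LAST letter. [folklore] -/
def runW (step : σ → α → Option σ) : (n : ℕ) → σ → (Fin n → α) → Option σ
  | 0, S, _ => some S
  | n + 1, S, w => (runW step n S (Fin.init w)).bind fun T => step T (w (Fin.last n))

/-- Number of words of length `n` accepted from state `S` (recursion on the FIRST letter). [folklore] -/
def cnt [Fintype α] (step : σ → α → Option σ) : σ → ℕ → ℕ
  | _, 0 => 1
  | S, n + 1 => ∑ a, match step S a with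
      | none => 0
      | some T => cnt step T n

/-- Value of a weight at an optional state (`0` at `none`). [folklore] -/
def optVal (V : σ → ℕ) : Option σ → ℕ
  | none => 0
  | some T => V T

/-- `optVal` at `none`. [folklore] -/
@[simp] theorem optVal_none (V : σ → ℕ) : optVal V none = 0 := rfl
/-- `optVal` at `some`. [folklore] -/
@[simp] theorem optVal_some (V : σ → ℕ) (T : σ) : optVal V (some T) = V T := rfl

/-- The empty word is accepted without moving. [folklore] -/
@[simp] theorem runW_zero (step : σ → α → Option σ) (S : σ) (w : Fin 0 → α) :
    runW step 0 S w = some S := rfl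

/-- Unfolding `runW` at a successor length. [folklore] -/
theorem runW_succ (step : σ → α → Option σ) (n : ℕ) (S : σ) (w : Fin (n + 1) → α) :
    runW step (n + 1) S w = (runW step n S (Fin.init w)).bind fun T => step T (w (Fin.last n)) := rfl

/-- Reading the first letter first: `run S (a · u) = step S a >>= run · u`. [folklore] -/
theorem runW_succ_eq_tail (step : σ → α → Option σ) :
    ∀ (n : ℕ) (S : σ) (w : Fin (n + 1) → α),
      runW step (n + 1) S w = (step S (w 0)).bind fun T => runW step n T (Fin.tail w) := by
  intro n
  induction n with
  | zero =>
    intro S w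
    rw [runW_succ, runW_zero, Option.bind_some]
    have h0 : w (Fin.last 0) = w 0 := rfl
    rw [h0]
    cases step S (w 0) <;> rfl
  | succ n ih =>
    intro S w
    rw [runW_succ, ih S (Fin.init w)]
    have h0 : Fin.init w 0 = w 0 := rfl
    rw [h0]
    cases hS : step S (w 0) with
    | none => rfl
    | some T =>
      simp only [Option.bind_some]
      rw [runW_succ]
      rfl

/-- **Accepted words are counted by `cnt`.** [folklore] -/
theorem card_accepted_eq_cnt [Fintype α] [DecidableEq α] (step : σ → α → Option σ) :
    ∀ (n : ℕ) (S : σ),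
      Fintype.card {w : Fin n → α // (runW step n S w).isSome} = cnt step S n := by
  intro n
  induction n with
  | zero => intro S; simp [cnt, runW]
  | succ n ih =>
    intro S
    classical
    -- split by the first letter
    have e : {w : Fin (n + 1) → α // (runW step (n + 1) S w).isSome} ≃
        Σ a : α, {u : Fin n → α // ((step S a).bind fun T => runW step n T u).isSome} :=
      { toFun := fun w => ⟨w.1 0, ⟨Fin.tail w.1, by
            have := w.2; rw [runW_succ_eq_tail] at this; exact this⟩⟩
        invFun := fun p => ⟨Fin.cons p.1 p.2.1, by
            rw [runW_succ_eq_tail, Fin.cons_zero, Fin.tail_cons]; exact p.2.2⟩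
        left_inv := fun w => by ext1; exact Fin.cons_self_tail w.1
        right_inv := fun p => by
          rcases p with ⟨a, u, hu⟩
          rfl }
    rw [Fintype.card_congr e, Fintype.card_sigma, cnt]
    refine Finset.sum_congr rfl fun a _ => ?_
    cases hS : step S a with
    | none => simp
    | some T => simp only [Option.bind_some]; exact ih T

/-- **Collatz–Wielandt counting bound.** If `R` is closed under `step`, `V` is a super-solution
`den · Σ_a V(step S a) ≤ num · V S` on `R`, and `m ≤ V` on `R`, then
`m · denⁿ · cnt S n ≤ numⁿ · V S` for every `S ∈ R`. [folklore] -/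
theorem cnt_le_of_certificate [Fintype α] (step : σ → α → Option σ) (R : Set σ)
    (hR : ∀ S ∈ R, ∀ a T, step S a = some T → T ∈ R) (V : σ → ℕ) (num den m : ℕ)
    (hV : ∀ S ∈ R, den * (∑ a, optVal V (step S a)) ≤ num * V S)
    (hm : ∀ S ∈ R, m ≤ V S) :
    ∀ (n : ℕ), ∀ S ∈ R, m * den ^ n * cnt step S n ≤ num ^ n * V S := by
  intro n
  induction n with
  | zero => intro S hS; simpa [cnt] using hm S hS
  | succ n ih =>
    intro S hS
    have key : m * den ^ n * (∑ a, match step S a with | none => 0 | some T => cnt step T n) ≤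
        num ^ n * (∑ a, optVal V (step S a)) := by
      rw [Finset.mul_sum, Finset.mul_sum]
      refine Finset.sum_le_sum fun a _ => ?_
      cases hSa : step S a with
      | none => simp
      | some T => exact ih T (hR S hS a T hSa)
    calc m * den ^ (n + 1) * cnt step S (n + 1)
        = den * (m * den ^ n * ∑ a, match step S a with | none => 0 | some T => cnt step T n) := by
          rw [cnt, pow_succ]; ring
      _ ≤ den * (num ^ n * ∑ a, optVal V (step S a)) := Nat.mul_le_mul_left _ key
      _ = num ^ n * (den * ∑ a, optVal V (step S a)) := by ring
      _ ≤ num ^ n * (num * V S) := Nat.mul_le_mul_left _ (hV S hS)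
      _ = num ^ (n + 1) * V S := by rw [pow_succ]; ring

end Automaton

/-! ### Memory-`τ` words on `ℤ^d` and the dangerous-set automaton -/

section Memory

variable {d : ℕ}

/-- The `ℓ¹` norm of a site of `ℤ^d`, as a natural number. [folklore] -/
def l1 (x : Site d) : ℕ := ∑ i, (x i).natAbs

/-- `ℓ¹` norm is invariant under negation. [folklore] -/
theorem l1_neg (x : Site d) : l1 (-x) = l1 x := by
  simp [l1]

/-- Triangle inequality for the `ℓ¹` norm. [folklore] -/
theorem l1_add_le (x y : Site d) : l1 (x + y) ≤ l1 x + l1 y := by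
  simp only [l1, Pi.add_apply, ← Finset.sum_add_distrib]
  exact Finset.sum_le_sum fun i _ => Int.natAbs_add_le _ _

/-- Unit steps have `ℓ¹` norm one. [folklore] -/
theorem l1_stepVec (e : Fin d × Bool) : l1 (stepVec e) = 1 := by
  rcases e with ⟨i, b⟩
  cases b <;> simp [l1, stepVec, Pi.single_apply, Finset.sum_ite_eq', apply_ite Int.natAbs]

/-- Moving by a unit step changes the `ℓ¹` norm by at most one. [folklore] -/
theorem l1_sub_stepVec_le (x : Site d) (e : Fin d × Bool) : l1 x ≤ l1 (x - stepVec e) + 1 := by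
  have := l1_add_le (x - stepVec e) (stepVec e)
  rwa [sub_add_cancel, l1_stepVec] at this

/-- A step word has **memory `τ`** if the sites visited at times `i < j ≤ i + τ` are distinct
(Madras–Slade's `c_{N,τ}` counts these). [cite: MadrasSlade1993, §1.2 (1.2.12) p. 10] -/
def IsMem (τ : ℕ) {n : ℕ} (w : Fin n → Fin d × Bool) : Prop :=
  ∀ i j : ℕ, j ≤ n → i < j → j ≤ i + τ → wordPos w i ≠ wordPos w j

/-- Self-avoiding words have every finite memory. [cite: MadrasSlade1993, §1.2 (1.2.13) p. 11] -/
theorem isMem_of_isSAW (τ : ℕ) {n : ℕ} {w : Fin n → Fin d × Bool} (h : IsSAW w) : IsMem τ w := by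
  intro i j hj hij _ heq
  have := h i j (by omega) hj heq
  omega

/-- Prefixes of memory-`τ` words have memory `τ`. [folklore] -/
theorem IsMem.wordInit {τ n : ℕ} {w : Fin (n + 1) → Fin d × Bool} (h : IsMem τ w) :
    IsMem τ (wordInit w) := by
  intro i j hj hij hτ
  rw [wordPos_wordInit w (by omega), wordPos_wordInit w hj]
  exact h i j (by omega) hij hτ

/-- Abstract automaton states: finite sets of (relative site, age) pairs. [folklore] -/
abbrev MState (d : ℕ) := Finset (Site d × ℕ)

/-- **The memory-`τ` automaton** on dangerous-site states: a step `e` is forbidden iff it lands on a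
remembered site; otherwise all remembered sites are shifted by `-e`, aged by one, the site just left is
added with age `1`, and sites that can no longer be revisited within the memory window are dropped.
[cite: PonitzTittmann2000, §2–§3 (the automaton A(d,k))] -/
def mstep (τ : ℕ) (S : MState d) (e : Fin d × Bool) : Option (MState d) :=
  if ∃ q ∈ S, q.1 = stepVec e then none
  else some (insert (-stepVec e, 1)
    ((S.image fun q => (q.1 - stepVec e, q.2 + 1)).filter fun q => q.2 ≤ τ - 1 ∧ l1 q.1 ≤ τ - q.2))

/-- The dangerous set of a word: the sites visited `j` steps ago, `1 ≤ j ≤ τ - 1`, seen from the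
current endpoint, that are within `ℓ¹`-distance `τ - j` (only those can be revisited in time). [folklore] -/
def danger (τ : ℕ) {n : ℕ} (w : Fin n → Fin d × Bool) : MState d :=
  ((Finset.Icc 1 (min (τ - 1) n)).filter fun j => l1 (wordPos w (n - j) - wordPos w n) ≤ τ - j).image
    fun j => (wordPos w (n - j) - wordPos w n, j)

/-- Membership in the dangerous set. [folklore] -/
theorem mem_danger {τ n : ℕ} (w : Fin n → Fin d × Bool) (q : Site d × ℕ) :
    q ∈ danger τ w ↔ 1 ≤ q.2 ∧ q.2 ≤ τ - 1 ∧ q.2 ≤ n ∧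
      q.1 = wordPos w (n - q.2) - wordPos w n ∧ l1 q.1 ≤ τ - q.2 := by
  rcases q with ⟨r, j⟩
  simp only [danger, Finset.mem_image, Finset.mem_filter, Finset.mem_Icc, Prod.mk.injEq]
  constructor
  · rintro ⟨j', ⟨⟨h1, h2⟩, h3⟩, rfl, rfl⟩
    exact ⟨h1, by omega, by omega, rfl, h3⟩
  · rintro ⟨h1, h2, h3, rfl, h5⟩
    exact ⟨j, ⟨⟨h1, by omega⟩, h5⟩, rfl, rfl⟩

/-- The empty word has empty dangerous set. [folklore] -/
theorem danger_zero (τ : ℕ) (w : Fin 0 → Fin d × Bool) : danger τ w = ∅ := by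
  ext q
  simp only [mem_danger, Finset.notMem_empty, iff_false]
  omega

/-- **The abstraction is exact on memory-`τ` words** (`τ ≥ 2`): reading the last letter of a
memory-`τ` word from the dangerous set of its prefix is allowed and yields its dangerous set. [folklore] -/
theorem mstep_danger_wordInit {τ n : ℕ} (hτ : 2 ≤ τ) (w : Fin (n + 1) → Fin d × Bool)
    (h : IsMem τ w) :
    mstep τ (danger τ (wordInit w)) (w (Fin.last n)) = some (danger τ w) := by
  set v := stepVec (w (Fin.last n)) with hv
  have hlast : wordPos w (n + 1) = wordPos w n + v := wordPos_succ w (Nat.lt_succ_self n)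
  unfold mstep
  rw [if_neg]
  · congr 1
    ext ⟨r, j⟩
    simp only [Finset.mem_insert, Finset.mem_filter, Finset.mem_image, Prod.mk.injEq, mem_danger,
      Prod.exists]
    constructor
    · rintro (⟨rfl, rfl⟩ | ⟨⟨r', j', hmem, rfl, rfl⟩, hj, hl⟩)
      · refine ⟨le_rfl, by omega, by omega, ?_, by rw [l1_neg, l1_stepVec]; omega⟩
        rw [Nat.add_sub_cancel, hlast]; abel
      · obtain ⟨h1, h2, h3, hr', h5⟩ := hmem
        refine ⟨by omega, hj, by omega, ?_, hl⟩
        rw [hr', wordPos_wordInit w (by omega), wordPos_wordInit w le_rfl, hlast,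
          show n + 1 - (j' + 1) = n - j' by omega]
        abel
    · rintro ⟨h1, h2, h3, hr, h5⟩
      by_cases hj1 : j = 1
      · subst hj1
        left
        refine ⟨?_, rfl⟩
        rw [hr, Nat.add_sub_cancel, hlast]; abel
      · right
        refine ⟨⟨r + v, j - 1, ?_, by abel, by omega⟩, h2, h5⟩
        refine ⟨by omega, by omega, by omega, ?_, ?_⟩
        · show r + v = _
          rw [wordPos_wordInit w (by omega), wordPos_wordInit w le_rfl, hr, hlast,
            show n - (j - 1) = n + 1 - j by omega]
          abel
        · show l1 (r + v) ≤ _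
          have := l1_sub_stepVec_le (r + v) (w (Fin.last n))
          rw [← hv, add_sub_cancel_right] at this
          omega
  · -- the step is allowed: landing on a remembered site would close a loop of length ≤ τ
    rintro ⟨⟨r, j⟩, hmem, hr⟩
    rw [mem_danger] at hmem
    obtain ⟨h1, h2, h3, hr', -⟩ := hmem
    simp only at hr hr' h1 h2 h3
    apply h (n - j) (n + 1) le_rfl (by omega) (by omega)
    rw [hlast, hv, ← hr, hr', wordPos_wordInit w (by omega), wordPos_wordInit w le_rfl]
    abel

/-- **Memory-`τ` words are accepted**, ending in their dangerous set. [folklore] -/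
theorem runW_mstep_of_isMem {τ : ℕ} (hτ : 2 ≤ τ) :
    ∀ {n : ℕ} (w : Fin n → Fin d × Bool), IsMem τ w → runW (mstep τ) n ∅ w = some (danger τ w) := by
  intro n
  induction n with
  | zero => intro w _; rw [runW_zero, danger_zero]
  | succ n ih =>
    intro w h
    rw [runW_succ, show Fin.init w = wordInit w from rfl, ih (wordInit w) h.wordInit, Option.bind_some,
      mstep_danger_wordInit hτ w h]

/-- **`σ(n) ≤ cnt(∅, n)`**: the self-avoiding words are among the words accepted by the memory-`τ`
automaton. [cite: MadrasSlade1993, §1.2 (1.2.13) p. 11 (c_N ≤ c_{N,τ})] -/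
theorem card_sawWords_le_cnt {τ : ℕ} (hτ : 2 ≤ τ) (n : ℕ) :
    (sawWords d n).card ≤ cnt (mstep τ) (∅ : MState d) n := by
  classical
  rw [← card_accepted_eq_cnt]
  have : (sawWords d n).card = Fintype.card {w : Fin n → Fin d × Bool // IsSAW w} := by
    rw [Fintype.card_subtype]; rfl
  rw [this]
  have hinj : Function.Injective (fun w : {w : Fin n → Fin d × Bool // IsSAW w} =>
      (⟨w.1, by rw [runW_mstep_of_isMem hτ w.1 (isMem_of_isSAW τ w.2)]; rfl⟩ :
        {w : Fin n → Fin d × Bool // (runW (mstep τ) n ∅ w).isSome})) := by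
    intro a b hab
    exact Subtype.ext (by simpa using congrArg Subtype.val hab)
  exact Fintype.card_le_of_injective _ hinj

end Memory

end Summit.CriticalPhenomena.PercolationContinuityZ3.Theorems.Pcint
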